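import Literature.Computability.Complexity.SymmetricThresholdProgramsSwitching
import Literature.Computability.Complexity.SymmetricThresholdProgramsReach
import Summits.PneNP.PneNP.Theorems.SymmetryBudgetNoHiddenOrderPerPathAtomsDefs

/-!
# `NoHiddenOrder` (stmt-PneNP-14781), (R2c) replay circuit I: the ATOM module — definitions

Route `PneNP/SymmetryBudget`.  The components-only Corneil–Goldberg process passes, after every refinement, to
the ATOM `BranchSum.atom G A col v` of the pointer `v` (`…PerPathAtomsDefs.lean`): iterate
`B ↦ swReach G B col v` (the vertices of `B` reachable from `v` in the switching-equivalent graph of the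
partition of `B`) from `A` to its fixed point, reached within `|A| + 1` rounds.  The symmetric-compilation kit
(`Literature/Computability/Complexity/SymmetricThresholdPrograms{Switching,Reach}.lean`) has the two gadgets
of one round; this file assembles `J` rounds: `AtomIter P V N T J` holds the shared adjacency / colour-kernel
wires, the start membership wires, the pointer, and for every round `j` a `Switching` gadget (on the current
membership) and a `Reach` gadget (on its switching edges), tied together by five consistency equations; the
membership entering round `j + 1` is "reachable from the pointer in round `j`" (`AtomIter.memW`).
The semantics (`AtomIter.memW_iff_iterate`, `AtomIter.memW_last_iff_atom`: the last membership wires read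
`atom G A col v`) is in `SymmetryBudgetNoHiddenOrderReplayAtom.lean`.  Definitions only; supports
stmt-PneNP-14781.
-/

set_option linter.dupNamespace false -- `Summit.PneNP.PneNP.…` (D-0017 single-conjunct layout)

namespace Summit.PneNP.PneNP.Theorems

open Finset Literature.Computability.Complexity Literature.Computability.Complexity.SymProg

variable {ι Λ : Type*} [DecidableEq ι] [DecidableEq Λ] (P : SymProg ι Λ)
variable (V : Type*) [Fintype V] [DecidableEq V] (N T J : ℕ)

/-- **The atom module**: `J` rounds of (switching graph of the current block, reachability from the pointer),
as kit gadgets with consistency equations. [folklore] -/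
structure AtomIter where
  /-- membership wires of the start block `A` -/
  mem0 : V → ι ⊕ Λ
  /-- adjacency wires (shared) -/
  adj : V → V → ι ⊕ Λ
  /-- colour-kernel wires `[col u = col v]` (shared) -/
  eq : V → V → ι ⊕ Λ
  /-- the pointer -/
  ptr : V
  /-- round `j`: the switching gadget on the current block -/
  sw : Fin J → P.Switching V N
  /-- round `j`: the reachability gadget on its switching edges -/
  rch : Fin J → P.Reach V T
  /-- the switching gadget of round `j` reads the current membership: the start block at round `0`, the
  vertices reachable from the pointer in round `j - 1` afterwards -/
  sw_mem : ∀ (j : Fin J) (u : V), (sw j).mem u =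
    if _h : (j : ℕ) = 0 then mem0 u else Sum.inr ((rch ⟨j - 1, by omega⟩).r (Fin.last T) ptr u)
  /-- it reads the shared adjacency -/
  sw_adj : ∀ j, (sw j).adj = adj
  /-- it reads the shared colour kernel -/
  sw_eq : ∀ j, (sw j).eq = eq
  /-- the reachability gadget of round `j` reads the same membership -/
  rch_mem : ∀ (j : Fin J) (u : V), (rch j).mem u = (sw j).mem u
  /-- and the switching edges of round `j` -/
  rch_edge : ∀ (j : Fin J) (a b : V), (rch j).edge a b = Sum.inr ((sw j).sw a b)

namespace AtomIter

variable {P V N T J} (AI : AtomIter P V N T J)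

/-- The membership wire entering round `j ≤ J` (for `j = J`: the OUTPUT membership of the module). [folklore] -/
def memW (j : Fin (J + 1)) (u : V) : ι ⊕ Λ :=
  if _h : (j : ℕ) = 0 then AI.mem0 u else Sum.inr ((AI.rch ⟨j - 1, by omega⟩).r (Fin.last T) AI.ptr u)

/-- Round `0` starts from the start block. [folklore] -/
theorem memW_zero (u : V) : AI.memW 0 u = AI.mem0 u := by simp [memW]

/-- The membership entering round `j + 1` is reachability from the pointer in round `j`. [folklore] -/
theorem memW_succ (j : Fin J) (u : V) : AI.memW j.succ u = Sum.inr ((AI.rch j).r (Fin.last T) AI.ptr u) := by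
  simp only [memW, Fin.val_succ, Nat.add_one_ne_zero, ↓reduceDIte, Nat.add_one_sub_one, Fin.eta]

/-- The switching gadget of round `j` reads `memW j`. [folklore] -/
theorem sw_mem_eq (j : Fin J) (u : V) : (AI.sw j).mem u = AI.memW j.castSucc u := by
  rw [AI.sw_mem]; unfold memW; simp only [Fin.val_castSucc]

/-- The reachability gadget of round `j` reads `memW j`. [folklore] -/
theorem rch_mem_eq (j : Fin J) (u : V) : (AI.rch j).mem u = AI.memW j.castSucc u := by
  rw [AI.rch_mem, sw_mem_eq]

/-- **Interpretation data** of an atom module on input `x`: the shared wires read the graph `G`, the kernel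
of the colouring `col` and the start block `A`. [folklore] -/
structure Reads (x : ι → Bool) (G : SimpleGraph V) (col : V → ℕ) (A : Finset V) : Prop where
  /-- adjacency wires read the graph -/
  adj_iff : ∀ a b, wval x (P.sem x) (AI.adj a b) = true ↔ G.Adj a b
  /-- kernel wires read the kernel of the colouring -/
  eq_iff : ∀ a b, wval x (P.sem x) (AI.eq a b) = true ↔ col a = col b
  /-- start membership wires read the start block -/
  mem0_iff : ∀ u, wval x (P.sem x) (AI.mem0 u) = true ↔ u ∈ A

end AtomIter

end Summit.PneNP.PneNP.Theorems
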